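import Summits.FinalStateConjecture.FinalStateConjecture.Theses.PhotonSphereChannels
import Literature.Geometry.Lorentzian.CoordCurvature
import Literature.Geometry.Lorentzian.RedShiftedHorizon

/-!
# Line `secular-modes-die-at-silent-ends` — skeleton for the crux
`PhotonSphereChannels.ChannelsResolveTameDevelopments` (item stmt-FinalStateConjecture-10046)

Route `route-FinalStateConjecture-PhotonSphereChannels` (rank 3); idea card
`Cruxes/ChannelsResolveTameDevelopments/Ideas/secular-modes-die-at-silent-ends.md` (ideator 3, round 1);
triage r1-1 / r1-2 / r1-3: pass / pass / pass (merge noted with `limit-bifurcation-sphere-hawking-collar` on the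
horizon lever); crux-plan by planner-cruxplan-stmt-FinalStateConjecture-10046-secular-modes-die-at-0, 2026-08-16.

## What is proved here and what is stubbed

The crux is FIXED and is concluded BY NAME: `ChannelsResolveTameDevelopments_of` at the bottom. As the standing
disprover recorded (`Disproof.lean`: `channelsResolve_iff`, `of_tameResolution`, `finalState_of_tameResolution`),
the crux is literally `K1 → Φ` with `K1 = UniformPhotonSphereChannels` refuted on paper (F1 ∧ F2; F3 =
`rw_channelEnergy_le` landed) — so the only honest content is the consequent `Φ` ("tame resolution": every MGHD of
admissible data with complete `𝓘⁺`, (i) no extremal-Kerr remnant, (ii) uniformly `C³`-tame outer region, admits an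
honest exhaustive `FinalStateDecomposition`). This line proves `Φ` OUTRIGHT (the antecedent `K1` is introduced and
never used), from five stubs, by the ω-limit / LaSalle architecture with THIS card's lever as the rigidity engine:

  two-sided tameness of an ETERNAL limit object freezes every secular mode — the `t`-polynomial hierarchy at the far
  end and the `e^{-nκv}` transversal tower at the horizon end — so both silent ends of every late-time limit are
  KILLING: a timelike `T` on the far zone (stub 2) and a Hawking-type `K` on an early collar of the horizon (stub 3).

## The objects (why coordinates)

`Spacetime 4` carries a `C^∞` metric, but ω-limits of a `C³`-tame region are only `C^{2,1}`; so a LIMIT OBJECT is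
typed in coordinates, exactly in the style of the eternal far charts of route EternalPapapetrou (stmt-10034/10745):
metric components `G : E4 → E4 →L[ℝ] E4 →L[ℝ] ℝ` on the eternal product domain `U = {y | y̲ ∉ K₀} = ℝ × K₀ᶜ`
(`K₀ ⊆ E3` compact: the excised deep interior), the clock being the coordinate `x⁰ = y 0`; vacuum is
`MetricCoord.ricAt G y = 0` and `∇_L L` is `fderiv L (L) + MetricCoord.chrAt G (L) (L)` (`CoordCurvature.lean`);
the horizon is the level set `{ρ = 0}` of a `C²` function with null non-degenerate gradient, `{ρ > 0}` the exterior,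
generator field `L` normalised by `L⁰ = 1` (so `κ` in `∇_L L = κ L` is surface gravity PER UNIT CLOCK TIME — the
two-sided `C²` bounds and the lapse bound are what make this normalisation rigid: the `κ₀⁻¹ log`-reparametrisation
that fakes a red shift on a degenerate horizon makes the components degenerate as `x⁰ → −∞`, violating clause 13).
The 26 hypothesis clauses `c1 … c26` of a limit object (written out verbatim in stubs 2–5; the same text each time):
 c1–c4 `0 ≤ M, 0 ≤ R, 0 < Λ, 0 < κ₀` · c5–c8 `K₀, K` compact, `K₀ᶜ` connected (no cavities), `K₀ ⊆ interior K ⊆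
 closedBall 0 R` · c9–c10 `G ∈ C²(U)`
 with `‖D^m G‖ ≤ Λ` (m ≤ 2) for ALL `x⁰ ∈ ℝ` (two-sided tameness) · c11 symmetry · c12 slices `{x⁰ = c}` uniformly
 spacelike · c13 future unit normal `N` with `‖N‖ ≤ Λ` (lapse/shift bound, time orientation `N⁰ > 0`) · c14 vacuum ·
 c15 far zone `{r > R}`: `r‖D^m(G − g_{M,0}^{KS})‖ ≤ Λ` (m ≤ 2; a weighted BOUND, so the far mass `M` and a boost of
 the hole are immaterial) · c16 two-sided silence at order `1/r`: `r‖D^m ∂₀G‖ → 0` as `r → ∞` uniformly in `x⁰`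
 (m ≤ 1) · c17 the far zone is exterior (`ρ > 0` on `{r > R}`) · c18 covering: the cylinder over `K` is inside the
 hole (`ρ < 0`), so the exterior is closed off by the horizon, not by the chart edge (no horizon ⇒ `K₀ = ∅`,
 `U = E4`) · c19–c20 `ρ ∈ C²`, `‖dρ‖ ≤ Λ`, `‖dρ‖ ≥ Λ⁻¹` on `{ρ = 0}` · c21–c22 `L ∈ C¹`, on the horizon
 `‖L‖, ‖DL‖ ≤ Λ`, `L⁰ = 1`, `L` null, tangent and normal (null hypersurface) · c23 `∇_L L = κ L`, `κ ≥ κ₀` (RED SHIFT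
 in the clock) · c24 non-expanding and shear-free · c25 compact horizon sections · c26 complete generators inside the
 horizon (ETERNAL horizon).

## Stubs (5, registered; names disjoint from the sibling line `limit-bifurcation-sphere-hawking-collar`) and composition
* `stub_tameRedShiftClock` (development level, tree vocabulary) — isolates triage objection X1: from the crux hypotheses,
  a TAME CLOCK `t` w.r.t. which the event horizon of the outer region is eventually red-shifted
  (`CauchyDevelopment.HasEventuallyRedShiftedHorizon`). Dies, and only it dies, if (i)-as-typed is too weak.
* `stub_farSecularFreezing` (THE LEVER, far end) — c1–c3, c5–c16 ⇒ timelike Killing `T` on `{r > R₁}` (shape of stmt-10034,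
  at the regularity limits have).
* `stub_horizonTransientFreezing` (THE LEVER, horizon end) — c3–c7, c9–c14, c18–c26 ⇒ Killing `Kv` on an open set containing
  the EARLY horizon `{ρ = 0, x⁰ < τ₁}`, null and tangent to the generators there.
* `stub_killingEndsRigidity` (HARDEST: bulk rigidity) — c1–c26 + both Killing ends ⇒ `{ρ > 0}` is `C²`-isometric onto a
  sub-extremal Kerr exterior `Kerr.exterior M' a` (`0 < M'`, `|a| < M'`) with `G = χ^* g_{M',a}^{KS}`, or there is no
  horizon and `(U, G)` is isometric onto Minkowski space.
* `stub_tameLaSalleTransfer` (transfer) — crux hypotheses + the red-shifted tame clock + rigidity of ALL limit objects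
  (c1–c26 ⇒ KerrChart, universally) ⇒ the crux's conclusion (compactness by Arzelà–Ascoli in a co-moving tame gauge
  per hole, inheritance of c1–c26 by limits, modulation/parameter freezing by the Bondi and area budgets, exhaustion).
* `ChannelsResolveTameDevelopments_of` — the kernel-checked composition (real proof, no sorry outside the stubs):
  `fun _K1 … hΦ => stub_tameLaSalleTransfer … hΦ (stub_tameRedShiftClock … hΦ) (fun … c1 … c26 => stub_killingEndsRigidity … (stub_farSecularFreezing …)
  (stub_horizonTransientFreezing …))`.

## Disproof used (Cruxes/ChannelsResolveTameDevelopments/Disproof.lean, cdisprove cycles 1–2, read 2026-08-16)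
`channelsResolve_iff` / `of_not_uniform` / `channelsResolve_of_F12`: honoured by construction — `K1` is never used, the
line proves `Φ` (`of_tameResolution` is the shape of `_of`). No `_false_without_` theorem or tightness lemma exists
yet for `Φ`; the landed Negative lemmas (`Negative/ExteriorEnergyAntitone`, `WaveSliceCalculus`,
`ShrinkingIntervalEnergy`: F3) concern `K1` only, and no stub is an instance of them or of a refuted statement
(`ledger negatives --problem FinalStateConjecture`: none bears on eternal rigidity / resolution). §5 of the Disproof
("`Φ` resists because it is an open problem both ways; a counterexample must be an AF vacuum breather/geon with
bounded geometry") is exactly what `stub_killingEndsRigidity` + `stub_farSecularFreezing` deny for ETERNAL TAME objects.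

## Triage answers (r1-1 §secular/§collar, r1-2 X1–X4, r1-3 §A1 and global note)
X1 (κ-floor not in (i)): isolated as `stub_tameRedShiftClock`; every other stub takes the red shift as the typed hypothesis
c23 / `HasEventuallyRedShiftedHorizon`. Clock tie (r1-1): the clock is part of the data — `t` with `|d(t∘Ψ) − λ dx⁰| ≤
λ/10`, `λ ∈ [c⁻¹, c]`, in `(1/10)`-pinched tame balls at the development level (bounded lapse, aligned frames), `x⁰`
itself with c12–c13 at the limit level; the
plane-wave / single-generator counterexamples are excluded by c19–c20 (level-set HYPERSURFACE), c25 (compact sections)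
and c13 (no degenerating lapse). X2 / §A1 (regularity): limits are typed at the regularity they have (`C²` with
bounds); the AIK/Carleman steps inside stubs 3–4 are therefore stated as TRUTHS at `C²`, and the line card asks the
route planner to raise (ii) to `C^k`, which changes only the constant `2` in c9–c10/c15/c19. X3 (area bound), frame
drift (α), weighted far field, horizon regularity, news-canonical foliation: all inside `stub_tameLaSalleTransfer`, named in
its docstring. X4 / far-cone counts: irrelevant here (no channel inequality anywhere). Early collar only (r1-3 (b)):
`CollarKilling` is stated for `{x⁰ < τ₁}`. Lewandowski–Pawłowski order-≥ 2 tower check (card falsifier (3)): it is the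
cheapest falsifier of `stub_horizonTransientFreezing` and is recorded as such in the line card.
-/

set_option maxSynthPendingDepth 3
set_option linter.dupNamespace false

noncomputable section

open Literature.Geometry.Lorentzian
open scoped Manifold ContDiff Topology

namespace Summit.FinalStateConjecture.FinalStateConjecture.Cruxes.ChannelsResolveTameDevelopments.SecularModesDieAtSilentEnds

/-! ## Stub 1 — the κ-floor in a tame clock (development level; isolates triage objection X1) -/

/-- STUB 1 `stub_tameRedShiftClock` (size: open-problem grade as typed — "dynamical third law for tame censored
developments"; becomes routine if the route restates (i) as `HasEventuallyRedShiftedHorizon`; sources: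
DafermosRodnianski2008 = arXiv:0811.0354 §7.1 Thm 7.1 (the `κ > 0` hypothesis, tree `RedShiftedHorizon.lean`),
arXiv:2306.17512 (Dunajski–Lucietti: every vacuum near-horizon geometry on `S²` is extremal Kerr's),
arXiv:1509.03469 (Li–Lucietti transverse rigidity), KehleUnger2025 / arXiv:2402.10190 (extremal formation is
threshold), Aretakis arXiv:1206.6598).
**Statement.** Under the hypotheses of the crux's consequent — admissible datum, MGHD `𝒟` with complete `𝓘⁺`,
(i) no late chart `C²`-converging to a boosted EXTREMAL Kerr exterior on every near-zone slab, (ii) `(r₀, Λ)`-tame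
outer region — there is a TAME CLOCK: a smooth `t : 𝒟 → ℝ` together with tame ball charts at every point of the outer
region (same shape as (ii), re-chosen: `C³`-bounded, `C⁰`-pinched to `η` within `1/10`) ALIGNED WITH THE CLOCK —
in each ball `d(t ∘ Ψ)` is within `10 %` of `λ_q dx⁰` for a lapse factor `λ_q ∈ [c⁻¹, c]` (one `c` for all points: the
lapse of `t` is bounded above and below for all times, and the tame frames are at rest in the clock's slicing) —
such that the event horizon `∂I⁻(outer) ∩ J⁺(Σ)` of the outer region is EVENTUALLY RED-SHIFTED w.r.t. `t`
(`CauchyDevelopment.HasEventuallyRedShiftedHorizon outer t`: generator `L` with `dt(L) = 1`, one `κ₀ > 0` for all late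
times). Exact Kerr passes with `t` = Kerr-star/Kerr–Schild time and Lorentz-normalised Kerr–Schild balls.
**Why plausibly true.** The secular lever at `κ = 0`: on an eternal tame limit with a degenerate horizon the
transversal tower has NO damping (`J_k(s) = J_k(0) + s F_k`), two-sided boundedness forces `F_k = 0`, so a cold limit
horizon is an extremal isolated horizon to all orders, pinned to the extremal-Kerr throat by Dunajski–Lucietti +
Li–Lucietti; the remaining step "cold tame limit ⇒ the forbidden extremal chart of (i)" (unique continuation off a
DEGENERATE horizon + non-recurrence of the parameters) is the honest open core of this stub (triage X1: possibly
false as (i) is typed — then the ROUTE repairs (i), not this line). Vacuous-direction sanity: no black hole ⇒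
`eventHorizonOf = ∅` ⇒ red shift holds (`HasEventuallyRedShiftedHorizon.of_eventHorizonOf_eq_empty`); the clock
clauses are then a re-choice of (ii)'s charts adapted to a temporal function. Uses (i) — the ONLY stub that does. -/
theorem stub_tameRedShiftClock :
    ∀ (X : Type) [TopologicalSpace X] [ChartedSpace E3 X] [IsManifold (𝓡 3) ((⊤ : ℕ∞) : WithTop ℕ∞) X] [T2Space X] [SecondCountableTopology X] [ConnectedSpace X], ∀ D ∈ admissibleVacuumData X, ∀ 𝒟 : VacuumCauchyDevelopment D, 𝒟.IsMaximal → Summit.FinalStateConjecture.HasCompleteNullInfinity 𝒟.toCauchyDevelopment →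
    ((∀ (Λ : lorentzGroup) (c : E4) (M a : ℝ), Kerr.IsExtremal M a → ¬ ∃ (τ₀ : ℝ) (Ψ : (boostedKerrBackground Λ c M a).domain → 𝒟.carrier), 𝒟.toSpacetime.IsLateChart (boostedKerrBackground Λ c M a) Set.univ τ₀ Ψ ∧ ∀ R : ℝ, Filter.Tendsto (fun τ => 𝒟.toSpacetime.truncDeviationCk (boostedKerrBackground Λ c M a) Ψ 2 R τ) Filter.atTop (nhds 0)) ∧ ∀ [𝒟.metric.HasLeviCivita], let outer : Set 𝒟.carrier := 𝒟.metric.causalFuture 𝒟.timeOrientation (Set.range 𝒟.embed) ∩ {q | ∃ (p : X) (γ : ℝ → 𝒟.carrier) (dom : Set ℝ), 𝒟.metric.IsNormalisedNullRayFrom 𝒟.timeOrientation 𝒟.embed 𝒟.normal p γ dom ∧ ¬ BddAbove dom ∧ q ∈ 𝒟.metric.chronologicalPast 𝒟.timeOrientation (γ '' (dom ∩ Set.Ici 0))}; ∃ r₀ : ℝ, 0 < r₀ ∧ ∃ Λ : NNReal, ∀ q ∈ outer, let U : TopologicalSpace.Opens E4 := ⟨Metric.ball (0 : E4) r₀, Metric.isOpen_ball⟩;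 ∃ Ψ : U → 𝒟.carrier, 𝒟.toSpacetime.IsLateChart (Minkowski.backgroundOn U) Set.univ (-r₀) Ψ ∧ (∃ x : U, (x : E4) = 0 ∧ Ψ x = q) ∧ supCkENorm (U : Set E4) 3 (𝒟.toSpacetime.deviationExtend (Minkowski.backgroundOn U) Ψ) ≤ (Λ : ENNReal) ∧ supCkENorm (U : Set E4) 0 (𝒟.toSpacetime.deviationExtend (Minkowski.backgroundOn U) Ψ) ≤ 1 / 2) →
    ∃ t : 𝒟.carrier → ℝ, ContMDiff (𝓡 4) 𝓘(ℝ, ℝ) (⊤ : ℕ∞) t ∧ ∀ [𝒟.metric.HasLeviCivita], let outer : Set 𝒟.carrier := 𝒟.metric.causalFuture 𝒟.timeOrientation (Set.range 𝒟.embed) ∩ {q | ∃ (p : X) (γ : ℝ → 𝒟.carrier) (dom : Set ℝ), 𝒟.metric.IsNormalisedNullRayFrom 𝒟.timeOrientation 𝒟.embed 𝒟.normal p γ dom ∧ ¬ BddAbove dom ∧ q ∈ 𝒟.metric.chronologicalPast 𝒟.timeOrientation (γ '' (dom ∩ Set.Ici 0))}; (∃ r₀ : ℝ, 0 < r₀ ∧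 ∃ Λ : NNReal, ∃ c : ℝ, 1 ≤ c ∧ ∀ q ∈ outer, let U : TopologicalSpace.Opens E4 := ⟨Metric.ball (0 : E4) r₀, Metric.isOpen_ball⟩; ∃ Ψ : U → 𝒟.carrier, 𝒟.toSpacetime.IsLateChart (Minkowski.backgroundOn U) Set.univ (-r₀) Ψ ∧ (∃ x : U, (x : E4) = 0 ∧ Ψ x = q) ∧ supCkENorm (U : Set E4) 3 (𝒟.toSpacetime.deviationExtend (Minkowski.backgroundOn U) Ψ) ≤ (Λ : ENNReal) ∧ supCkENorm (U : Set E4) 0 (𝒟.toSpacetime.deviationExtend (Minkowski.backgroundOn U) Ψ) ≤ 1 / 10 ∧ let f : E4 → ℝ := Function.extend Subtype.val (t ∘ Ψ) 0; ∃ lam : ℝ, c⁻¹ ≤ lam ∧ lam ≤ c ∧ ∀ x : U, ∀ v : E4, |fderiv ℝ f x.1 v - lam * v 0| ≤ (lam / 10) * ‖v‖) ∧ 𝒟.toCauchyDevelopment.HasEventuallyRedShiftedHorizon outer t := by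
  sorry

/-! ## Stub 2 — THE LEVER, far end: secular (t-polynomial) modes of an eternal tame far zone are frozen -/

/-- STUB 2 `stub_farSecularFreezing` (size XL; sources: arXiv:1504.04592 §§3–4 and Thm 1.3 (Alexakis–Schlue: periodicity is
used "only to rule out linear growth" — here two-sided boundedness c10 does that), arXiv:1312.1989
(Alexakis–Schlue–Shao unique continuation from infinity), doi:10.1063/1.1704792 (Papapetrou), BicakScholtzTod2010,
arXiv:1404.7836 (non-radiative hierarchies), stmt-FinalStateConjecture-10034 `EternalPapapetrou.FarZoneEternalPapapetrou`
(same conclusion, Rellich mechanism, smooth setting) — this is its `C²`, fixed-order twin).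
**Statement.** Let `G` be metric components on `U = ℝ × K₀ᶜ` with c1–c3, c5–c16: two-sided `C²` bounds, uniformly
spacelike slices and bounded lapse, VACUUM, far zone `{r > R}` within `Λ/r` of Schwarzschild–Kerr–Schild `g_{M,0}`
with two derivatives (weighted bound), and TWO-SIDED SILENT at order `1/r` (`r‖D^m ∂₀ G‖ → 0` as `r → ∞` uniformly in
the clock, m ≤ 1: no news out, none in, at all times). Then `G` carries on some `{r > R₁}` a `C¹` vector field `T`
with `G(T,T) < 0` and `𝓛_T G = 0` (coordinate Killing equation `DG·T + G(DT·,·) + G(·,DT·) = 0`): STATIONARY NEAR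
INFINITY, no inner boundary condition.
**Why plausibly true (the lever).** Every degree of freedom the vacuum equations propagate along the silent far
end evolves SECULARLY — polynomially in `u` (the non-radiative Bondi/NP hierarchy at finite large `r`; linearly: the
`t`-polynomial kernel of the channel identity; `supp Ĝ(ω) ⊆ {0}` after c16 kills `ω ≠ 0` Jost pairs) — and a
polynomial bounded for `x⁰ → −∞` AND `x⁰ → +∞` (c10) is constant: Killing to infinite order in the far zone, then a
perturbative fixed point at finite `r` (no expansion at a conformal boundary, so `NonSmoothNullInfinity` does not
bite). Honest `_false_without_`: drop two-sidedness/uniformity of c10 and `t · ψ_static` (r∂₀ → 0 for ℓ ≥ 1) is a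
non-stationary silent vacuum-linearised solution; drop c16 and standing waves survive. Unused data: none of the
horizon clauses (far statement). -/
theorem stub_farSecularFreezing :
    ∀ (K₀ K : Set E3) (M R Λ : ℝ) (G : E4 → E4 →L[ℝ] E4 →L[ℝ] ℝ) (N : E4 → E4),
    0 ≤ M →
    0 ≤ R →
    0 < Λ →
    (IsCompact K₀ ∧ IsConnected K₀ᶜ) →
    IsCompact K →
    K₀ ⊆ interior K →
    K ⊆ Metric.closedBall (0 : E3) R →
    ContDiffOn ℝ 2 G {y : E4 | E4.spatial y ∉ K₀} →
    (∀ y : E4, E4.spatial y ∉ K₀ → ∀ m ≤ 2, ‖iteratedFDeriv ℝ m G y‖ ≤ Λ) →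
    (∀ y : E4, E4.spatial y ∉ K₀ → ∀ v w : E4, G y v w = G y w v) →
    (∀ y : E4, E4.spatial y ∉ K₀ → ∀ v : E4, v 0 = 0 → Λ⁻¹ * ‖v‖ ^ 2 ≤ G y v v) →
    (∀ y : E4, E4.spatial y ∉ K₀ → (∀ v : E4, v 0 = 0 → G y (N y) v = 0) ∧ G y (N y) (N y) = -1 ∧ ‖N y‖ ≤ Λ ∧ 0 < N y 0) →
    (∀ y : E4, E4.spatial y ∉ K₀ → MetricCoord.ricAt G y = 0) →
    (∀ y : E4, E4.spatial y ∉ K₀ → R < E4.spatialNorm y → ∀ m ≤ 2, ‖iteratedFDeriv ℝ m (fun z => G z - Kerr.bilin M 0 z) y‖ * E4.spatialNorm y ≤ Λ) →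
    (∀ δ : ℝ, 0 < δ → ∃ R' : ℝ, ∀ y : E4, E4.spatial y ∉ K₀ → R' < E4.spatialNorm y → ∀ m ≤ 1, ‖iteratedFDeriv ℝ m (fun z => fderiv ℝ G z (E4.basisVector 0)) y‖ * E4.spatialNorm y ≤ δ) →
    ∃ (R₁ : ℝ) (T : E4 → E4), R ≤ R₁ ∧ ContDiffOn ℝ 1 T {y : E4 | R₁ < E4.spatialNorm y} ∧ ∀ y : E4, R₁ < E4.spatialNorm y → G y (T y) (T y) < 0 ∧ ∀ v w : E4, fderiv ℝ G y (T y) v w + G y (fderiv ℝ T y v) w + G y v (fderiv ℝ T y w) = 0 := by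
  sorry

/-! ## Stub 3 — THE LEVER, horizon end: red-shift transients `e^{-nκv}` of an eternal tame NEH are frozen -/

/-- STUB 3 `stub_horizonTransientFreezing` (size XL; sources: arXiv:0902.1173 Thm 1.1 (Alexakis–Ionescu–Klainerman: Killing
field near a regular BIFURCATE non-expanding horizon in smooth vacuum, no stationarity, nothing global),
doi:10.1088/0264-9381/9/12/008 and doi:10.1088/0264-9381/13/3/017 (Rácz–Wald bifurcate completions from `κ ≠ 0`),
gr-qc/9811021 §3 (Friedrich–Rácz–Wald jet recursion), gr-qc/0111067 §4.2/App. A and arXiv:1404.7836 §§4–5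
(Ashtekar–Beetle–Lewandowski, Lewandowski–Pawłowski: transversal data of NEHs, the `e^{-κv}` freedom, the tower to be
frozen), arXiv:1903.09135 Thms 1.4/1.9 and arXiv:1809.02580 (Petersen, Petersen–Rácz: the compact-horizon analogue),
arXiv:1512.08260 (blue-shift of `𝓗⁻` data); linear pilot `TameEternalWavesFallIn` in `SketchIdeator3.lean`).
**Statement.** Let `G` on `U = ℝ × K₀ᶜ` satisfy c3–c7, c9–c14 (two-sided `C²`-tame, bounded lapse, vacuum) and carry
an ETERNAL horizon: the level set `{ρ = 0}` (c18–c20: `C²`, non-degenerate, closing the exterior off from the chart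
edge) is a null hypersurface with generator `L`, `L⁰ = 1` (c21–c22), RED-SHIFTED `∇_L L = κ L`, `κ ≥ κ₀ > 0` in the
clock `x⁰` (c23), non-expanding and shear-free (c24), with compact sections (c25) and complete generators (c26). Then
there are `τ₁`, an open `O ⊇ {ρ = 0, x⁰ < τ₁}` inside `U` and a `C¹` field `Kv` on `O` with `𝓛_{Kv} G = 0` on `O`,
which on the early horizon is non-zero, null and tangent (hence along the generators): a KILLING COLLAR OF THE EARLY
HORIZON.
**Why plausibly true (the lever).** In null coordinates adapted to `{ρ = 0}` the vacuum equations transport the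
transversal jets by `∂_v X_n + nκ X_n = F_n(X_{<n})`; the homogeneous modes `C e^{-nκv}` blow up as `v → −∞`, so
two-sided boundedness (c10, c22 — meaningful because c13 forbids the reparametrisation that would fake `κ > 0`) freezes
the whole available jet: the horizon data are Killing to the available order, the boost-renormalised past completion
is a bifurcate NEH, and AIK's local rigidity yields `Kv` near the virtual bifurcation sphere = on an EARLY collar
(r1-3 (b): not along the whole horizon; that continuation is left to stub 4). Regularity caveat (X2/§A1): with `C²`
data the completion is only `C¹` and AIK is printed for `C^∞` — the statement is asserted as a TRUTH at `C²`; its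
proof may need the route to raise (ii). Cheapest falsifier: an undamped order-≥ 2 free datum in the
Lewandowski–Pawłowski tower (one afternoon with arXiv:1404.7836 §§4–5). Linear shadow TRUE (triage r1-1/2/3:
`TameEternalWavesFallIn`). -/
theorem stub_horizonTransientFreezing :
    ∀ (K₀ K : Set E3) (Λ κ₀ : ℝ) (G : E4 → E4 →L[ℝ] E4 →L[ℝ] ℝ) (N L : E4 → E4) (ρ κ : E4 → ℝ),
    0 < Λ →
    0 < κ₀ →
    (IsCompact K₀ ∧ IsConnected K₀ᶜ) →
    IsCompact K →
    K₀ ⊆ interior K →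
    ContDiffOn ℝ 2 G {y : E4 | E4.spatial y ∉ K₀} →
    (∀ y : E4, E4.spatial y ∉ K₀ → ∀ m ≤ 2, ‖iteratedFDeriv ℝ m G y‖ ≤ Λ) →
    (∀ y : E4, E4.spatial y ∉ K₀ → ∀ v w : E4, G y v w = G y w v) →
    (∀ y : E4, E4.spatial y ∉ K₀ → ∀ v : E4, v 0 = 0 → Λ⁻¹ * ‖v‖ ^ 2 ≤ G y v v) →
    (∀ y : E4, E4.spatial y ∉ K₀ → (∀ v : E4, v 0 = 0 → G y (N y) v = 0) ∧ G y (N y) (N y) = -1 ∧ ‖N y‖ ≤ Λ ∧ 0 < N y 0) →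
    (∀ y : E4, E4.spatial y ∉ K₀ → MetricCoord.ricAt G y = 0) →
    (∀ y : E4, E4.spatial y ∉ K₀ → E4.spatial y ∈ K → ρ y < 0) →
    ContDiffOn ℝ 2 ρ {y : E4 | E4.spatial y ∉ K₀} →
    (∀ y : E4, E4.spatial y ∉ K₀ → ‖fderiv ℝ ρ y‖ ≤ Λ ∧ (ρ y = 0 → Λ⁻¹ ≤ ‖fderiv ℝ ρ y‖)) →
    ContDiffOn ℝ 1 L {y : E4 | E4.spatial y ∉ K₀} →
    (∀ y : E4, E4.spatial y ∉ K₀ → ρ y = 0 → ‖L y‖ ≤ Λ ∧ ‖fderiv ℝ L y‖ ≤ Λ ∧ L y 0 = 1 ∧ G y (L y) (L y) = 0 ∧ fderiv ℝ ρ y (L y) = 0 ∧ ∀ X : E4, fderiv ℝ ρ y X = 0 → G y (L y) X = 0) →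
    (∀ y : E4, E4.spatial y ∉ K₀ → ρ y = 0 → fderiv ℝ L y (L y) + MetricCoord.chrAt G y (L y) (L y) = κ y • L y ∧ κ₀ ≤ κ y) →
    (∀ y : E4, E4.spatial y ∉ K₀ → ρ y = 0 → ∀ X Y : E4, fderiv ℝ ρ y X = 0 → fderiv ℝ ρ y Y = 0 → G y (fderiv ℝ L y X + MetricCoord.chrAt G y X (L y)) Y + G y X (fderiv ℝ L y Y + MetricCoord.chrAt G y Y (L y)) = 0) →
    (∀ c : ℝ, IsCompact {y : E4 | E4.spatial y ∉ K₀ ∧ ρ y = 0 ∧ y 0 = c}) →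
    (∀ y : E4, E4.spatial y ∉ K₀ → ρ y = 0 → ∃ γ : ℝ → E4, γ 0 = y ∧ ∀ s : ℝ, HasDerivAt γ (L (γ s)) s ∧ E4.spatial (γ s) ∉ K₀ ∧ ρ (γ s) = 0) →
    ∃ (τ₁ : ℝ) (O : Set E4) (Kv : E4 → E4), IsOpen O ∧ O ⊆ {y : E4 | E4.spatial y ∉ K₀} ∧ {y : E4 | E4.spatial y ∉ K₀ ∧ ρ y = 0 ∧ y 0 < τ₁} ⊆ O ∧ ContDiffOn ℝ 1 Kv O ∧ (∀ y ∈ O, ∀ v w : E4, fderiv ℝ G y (Kv y) v w + G y (fderiv ℝ Kv y v) w + G y v (fderiv ℝ Kv y w) = 0) ∧ ∀ y : E4, E4.spatial y ∉ K₀ → ρ y = 0 → y 0 < τ₁ → Kv y ≠ 0 ∧ G y (Kv y) (Kv y) = 0 ∧ fderiv ℝ ρ y (Kv y) = 0 := by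
  sorry

/-! ## Stub 4 — HARDEST: the handshake / bulk rigidity of an eternal tame doubly-silent object with Killing ends -/

/-- STUB 4 `stub_killingEndsRigidity` — HARDEST (open-problem grade: contains smooth stationary no-hair of Ionescu–Klainerman
type with LESS than a global `T`; sources: IonescuKlainerman2012 and arXiv:1108.3575 Def 1.1/Thm 1.2 (extension of
Killing fields across (conditionally) pseudo-convex hypersurfaces; strong pseudo-convexity of `{r = r₁}` flips sign
exactly at the photon sphere, `schwarzschild_turning_acceleration` in `SketchIdeator3.lean`), AlexakisIonescuKlainerman2009
/ arXiv:0904.0982 (AIK: extend `K` from `S` under Mars–Simon smallness), arXiv:0902.1131 (Alexakis: vacuum unique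
continuation to the pseudoconvexity radius), arXiv:1402.7034 §1 (DRSR: threshold null geodesics untrapped for
`|a| < M`), gr-qc/9510015 (Beig–Chruściel: 2-dim Killing algebra of an AF end is axial), ChruscielCosta2008 Thm 1.3
(smooth stationary-axisymmetric uniqueness), Sudarsky–Wald PRD 47 (1993) R5209 (staticity), tree
`Anderson2000_stationaryVacuum_flat` (complete stationary vacuum ⇒ flat), stmt-FinalStateConjecture-10745
`EternalPapapetrou.EternalStationaryExteriorIsKerr` (the harder cousin without the horizon collar)).
**Statement.** A limit object with ALL of c1–c26 which is stationary near infinity (the conclusion of stub 2) and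
Killing on an early horizon collar (the conclusion of stub 3) is KERR OUTSIDE: either there are `0 < M'`, `|a| < M'`
and a `C²` injective local diffeomorphism `χ` of the exterior `{ρ > 0}` ONTO `Kerr.exterior M' a` with
`G = χ^* g_{M',a}` (Kerr–Schild form `Kerr.bilin`), or there is no horizon at all (`ρ > 0` on `U`, hence `K₀ = ∅`,
`U = E4` by c18) and `(U, G)` is `C²`-isometric onto Minkowski space `(E4, η)`.
**Why plausibly true / where it is open.** `T` continues inward from the far zone while `T`-conditionally
pseudo-convex (unconditionally to the pseudoconvexity radius; IK-conditionally to the ergosurface), `Kv` continues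
outward from the early collar while `Kv`-conditionally pseudo-convex (threshold perihelion), both marches stopping at
the photon region from opposite sides; on the overlap `span{T, Kv}` is a 2-dimensional Killing algebra of an AF vacuum
end ⇒ axisymmetry ⇒ Kerr (Chruściel–Costa) or `T ∥ Kv` ⇒ static ⇒ Schwarzschild; eternity + two-sidedness then
propagate the early-slab identification to all of `{ρ > 0}`; `|a| < M'` because c23 forbids `κ = 0`; one component
and one hole because a 2-hole eternal silent vacuum equilibrium does not exist (open: part of the claim); no horizon
⇒ complete stationary vacuum ⇒ flat (Lichnerowicz/Anderson) once `T` is global. Honest residuals: the belt between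
ergosurface and threshold perihelion for rapidly rotating limits (`|a|/M' > 0.91` with the naive weights), the
`C²` regularity, and IK's open global step — this is where the line is expected to stall first. Cheap instances
checked: exact Kerr–Schild Schwarzschild/Kerr (`χ = id`), boosted or drifting holes (excluded by c18/c25), Taub–NUT
and C-metric (excluded by c15/c16), super-extremal/negative mass (not `C²` on `U = E4`). -/
theorem stub_killingEndsRigidity :
    ∀ (K₀ K : Set E3) (M R Λ κ₀ : ℝ) (G : E4 → E4 →L[ℝ] E4 →L[ℝ] ℝ) (N L : E4 → E4) (ρ κ : E4 → ℝ),
    0 ≤ M →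
    0 ≤ R →
    0 < Λ →
    0 < κ₀ →
    (IsCompact K₀ ∧ IsConnected K₀ᶜ) →
    IsCompact K →
    K₀ ⊆ interior K →
    K ⊆ Metric.closedBall (0 : E3) R →
    ContDiffOn ℝ 2 G {y : E4 | E4.spatial y ∉ K₀} →
    (∀ y : E4, E4.spatial y ∉ K₀ → ∀ m ≤ 2, ‖iteratedFDeriv ℝ m G y‖ ≤ Λ) →
    (∀ y : E4, E4.spatial y ∉ K₀ → ∀ v w : E4, G y v w = G y w v) →
    (∀ y : E4, E4.spatial y ∉ K₀ → ∀ v : E4, v 0 = 0 → Λ⁻¹ * ‖v‖ ^ 2 ≤ G y v v) →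
    (∀ y : E4, E4.spatial y ∉ K₀ → (∀ v : E4, v 0 = 0 → G y (N y) v = 0) ∧ G y (N y) (N y) = -1 ∧ ‖N y‖ ≤ Λ ∧ 0 < N y 0) →
    (∀ y : E4, E4.spatial y ∉ K₀ → MetricCoord.ricAt G y = 0) →
    (∀ y : E4, E4.spatial y ∉ K₀ → R < E4.spatialNorm y → ∀ m ≤ 2, ‖iteratedFDeriv ℝ m (fun z => G z - Kerr.bilin M 0 z) y‖ * E4.spatialNorm y ≤ Λ) →
    (∀ δ : ℝ, 0 < δ → ∃ R' : ℝ, ∀ y : E4, E4.spatial y ∉ K₀ → R' < E4.spatialNorm y → ∀ m ≤ 1, ‖iteratedFDeriv ℝ m (fun z => fderiv ℝ G z (E4.basisVector 0)) y‖ * E4.spatialNorm y ≤ δ) →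
    (∀ y : E4, E4.spatial y ∉ K₀ → R < E4.spatialNorm y → 0 < ρ y) →
    (∀ y : E4, E4.spatial y ∉ K₀ → E4.spatial y ∈ K → ρ y < 0) →
    ContDiffOn ℝ 2 ρ {y : E4 | E4.spatial y ∉ K₀} →
    (∀ y : E4, E4.spatial y ∉ K₀ → ‖fderiv ℝ ρ y‖ ≤ Λ ∧ (ρ y = 0 → Λ⁻¹ ≤ ‖fderiv ℝ ρ y‖)) →
    ContDiffOn ℝ 1 L {y : E4 | E4.spatial y ∉ K₀} →
    (∀ y : E4, E4.spatial y ∉ K₀ → ρ y = 0 → ‖L y‖ ≤ Λ ∧ ‖fderiv ℝ L y‖ ≤ Λ ∧ L y 0 = 1 ∧ G y (L y) (L y) = 0 ∧ fderiv ℝ ρ y (L y) = 0 ∧ ∀ X : E4, fderiv ℝ ρ y X = 0 → G y (L y) X = 0) →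
    (∀ y : E4, E4.spatial y ∉ K₀ → ρ y = 0 → fderiv ℝ L y (L y) + MetricCoord.chrAt G y (L y) (L y) = κ y • L y ∧ κ₀ ≤ κ y) →
    (∀ y : E4, E4.spatial y ∉ K₀ → ρ y = 0 → ∀ X Y : E4, fderiv ℝ ρ y X = 0 → fderiv ℝ ρ y Y = 0 → G y (fderiv ℝ L y X + MetricCoord.chrAt G y X (L y)) Y + G y X (fderiv ℝ L y Y + MetricCoord.chrAt G y Y (L y)) = 0) →
    (∀ c : ℝ, IsCompact {y : E4 | E4.spatial y ∉ K₀ ∧ ρ y = 0 ∧ y 0 = c}) →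
    (∀ y : E4, E4.spatial y ∉ K₀ → ρ y = 0 → ∃ γ : ℝ → E4, γ 0 = y ∧ ∀ s : ℝ, HasDerivAt γ (L (γ s)) s ∧ E4.spatial (γ s) ∉ K₀ ∧ ρ (γ s) = 0) →
    (∃ (R₁ : ℝ) (T : E4 → E4), R ≤ R₁ ∧ ContDiffOn ℝ 1 T {y : E4 | R₁ < E4.spatialNorm y} ∧ ∀ y : E4, R₁ < E4.spatialNorm y → G y (T y) (T y) < 0 ∧ ∀ v w : E4, fderiv ℝ G y (T y) v w + G y (fderiv ℝ T y v) w + G y v (fderiv ℝ T y w) = 0) →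
    (∃ (τ₁ : ℝ) (O : Set E4) (Kv : E4 → E4), IsOpen O ∧ O ⊆ {y : E4 | E4.spatial y ∉ K₀} ∧ {y : E4 | E4.spatial y ∉ K₀ ∧ ρ y = 0 ∧ y 0 < τ₁} ⊆ O ∧ ContDiffOn ℝ 1 Kv O ∧ (∀ y ∈ O, ∀ v w : E4, fderiv ℝ G y (Kv y) v w + G y (fderiv ℝ Kv y v) w + G y v (fderiv ℝ Kv y w) = 0) ∧ ∀ y : E4, E4.spatial y ∉ K₀ → ρ y = 0 → y 0 < τ₁ → Kv y ≠ 0 ∧ G y (Kv y) (Kv y) = 0 ∧ fderiv ℝ ρ y (Kv y) = 0) →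
    (∃ (M' a : ℝ) (χ : E4 → E4), 0 < M' ∧ |a| < M' ∧ ContDiffOn ℝ 2 χ {y : E4 | E4.spatial y ∉ K₀ ∧ 0 < ρ y} ∧ Set.InjOn χ {y : E4 | E4.spatial y ∉ K₀ ∧ 0 < ρ y} ∧ χ '' {y : E4 | E4.spatial y ∉ K₀ ∧ 0 < ρ y} = (Kerr.exterior M' a : Set E4) ∧ ∀ y : E4, E4.spatial y ∉ K₀ → 0 < ρ y → (fderiv ℝ χ y).IsInvertible ∧ ∀ v w : E4, G y v w = Kerr.bilin M' a (χ y) (fderiv ℝ χ y v) (fderiv ℝ χ y w)) ∨ ((∀ y : E4, E4.spatial y ∉ K₀ → 0 < ρ y) ∧ ∃ χ : E4 → E4, ContDiffOn ℝ 2 χ {y : E4 | E4.spatial y ∉ K₀} ∧ Set.InjOn χ {y : E4 | E4.spatial y ∉ K₀} ∧ χ '' {y : E4 | E4.spatial y ∉ K₀} = Set.univ ∧ ∀ y : E4, E4.spatial y ∉ K₀ → (fderiv ℝ χ y).IsInvertible ∧ ∀ v w : E4, G y v w = Minkowski.bilin (fderiv ℝ χ y v) (fderiv ℝ χ y w)) :=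 by
  sorry

/-! ## Stub 5 — the transfer: rigidity of eternal tame limit objects ⇒ tame red-shifted developments resolve -/

/-- STUB 5 `stub_tameLaSalleTransfer` (size XL / open-problem grade in its a-priori parts; sources: KenigMerle2006 and
doi:10.4310/cjm.2013.v1.n1.a3 (DKM: compactness ⇒ rigidity on eternal critical elements ⇒ resolution),
arXiv:1601.01871 (sequential resolution from a monotone flux), Anderson 2004 = gr-qc/0208079 Thm 5.1 and §5 (Lorentzian
Cheeger–Gromov in a temporal gauge; tree `BoundedGeometry.lean`, `SpacetimeLocalConvergence.lean`,
`LateTimeOmegaLimitSet.lean` — `translatedChartMetric`, `lateTimeOmegaLimitSet`), arXiv:2508.15441 (temporal functions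
for Lorentzian convergence), ChruscielEtAl2001 = gr-qc/0001003 Thm 1.1 (area theorem; tree `EventHorizonAreaLaw`),
Christodoulou–Klainerman Ch. 17 / tree `BondiNewsFlux` (`IsNewsCanonical.newsFlux_univ_le`, `tendsto_newsFlux_Ici`),
arXiv:2104.08222 §1 and KlainermanSzeftel2023 (chart-level convergence; capture), tree
`StationaryFinalStateDecomposition.toFinalStateDecomposition`, `AsymptoticallyStationaryExhaustion`,
`QuasiFinalStateDecomposition` (bookkeeping of the endgame); stmt-FinalStateConjecture-10037
`EternalPapapetrou.LaSalleTransfer` (same transfer without tameness, harder)).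
**Statement.** Assume, for an MGHD `𝒟` as in the crux (complete `𝓘⁺`, (i), (ii)), the red-shifted tame clock of
stub 1, and assume RIGIDITY OF LIMIT OBJECTS: every `(K₀, K, M, R, Λ, κ₀, G, N, L, ρ, κ)` with c1–c26 is Kerr outside
or horizonless-flat (`KerrChart`, the conclusion of stub 4) — universally, not only for limits of this `𝒟`. Then `𝒟`
RESOLVES: some `O` carries an honest `2`-decomposition `d` with `O = exteriorOf 𝒟 d.charted` and
`HasExhaustiveCharts d` (the crux's conclusion verbatim).
**Content the prover supplies (all named; none is a channel inequality).** (a) GAUGE per hole: from (ii)'s balls and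
the clock `t` (whose pinched differential kills frame drift, triage α) a co-moving product chart
`(τ₀, ∞) × K₀ᶜ → 𝒟` around each eventual hole and one for the radiation zone, with uniform `C³` bounds, bounded lapse,
the event horizon as a level set; (b) COMPACTNESS: Arzelà–Ascoli on the translates `G(· + Tₙ ∂₀)` ⇒ `C²_loc` limits on
`ℝ × K₀ᶜ`; (c) INHERITANCE of c1–c26: two-sided bounds and vacuum (free), weighted far field c15 (asymptotic
flatness propagated, Klainerman–Nicolò), silence c16 (outgoing: Bondi budget + Barbalat under tameness; incoming: none
at late advanced time), horizon regularity c19–c22 and red shift c23 (from `HasEventuallyRedShiftedHorizon outer t`,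
clock `x⁰ = t − Tₙ`, `L⁰ = dt(L) = 1`), NEH c24 (area theorem + an AREA BOUND for late horizon sections, triage X3 —
an input proved here, Penrose-type), c25–c26, c17–c18 (tame balls centred near `𝓗⁺` reach inside); (d) ENDGAME: all
limits Kerr with `(M', |a|)` frozen by the two monotone budgets (`M_B ↓ M_f`, `A ↑ A_f`), finitely many holes by the
curvature quantum of (ii) (`Kretschmann ≥ 3/(4M⁴)` on a Kerr horizon vs `≤ c(Λ)` in a tame ball), holes separate or
merge (a bounded-distance pair would be a 2-hole limit object, excluded by rigidity), `C²` convergence on growing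
near zones by interpolation against the `C³` bound, horizon-normalised charts ⇒ `HasExhaustiveCharts`, and
`O = exteriorOf` from maximality. Why it might fail: the area bound and horizon regularity at late times are
genuine inputs; news-canonical foliations for large data (`IsNewsCanonical` is a hypothesis structure) must be built
from complete `𝓘⁺` + (ii). Does NOT use (i) (red shift arrives typed, from stub 1). -/
theorem stub_tameLaSalleTransfer :
    ∀ (X : Type) [TopologicalSpace X] [ChartedSpace E3 X] [IsManifold (𝓡 3) ((⊤ : ℕ∞) : WithTop ℕ∞) X] [T2Space X] [SecondCountableTopology X] [ConnectedSpace X], ∀ D ∈ admissibleVacuumData X, ∀ 𝒟 : VacuumCauchyDevelopment D, 𝒟.IsMaximal → Summit.FinalStateConjecture.HasCompleteNullInfinity 𝒟.toCauchyDevelopment →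
    ((∀ (Λ : lorentzGroup) (c : E4) (M a : ℝ), Kerr.IsExtremal M a → ¬ ∃ (τ₀ : ℝ) (Ψ : (boostedKerrBackground Λ c M a).domain → 𝒟.carrier), 𝒟.toSpacetime.IsLateChart (boostedKerrBackground Λ c M a) Set.univ τ₀ Ψ ∧ ∀ R : ℝ, Filter.Tendsto (fun τ => 𝒟.toSpacetime.truncDeviationCk (boostedKerrBackground Λ c M a) Ψ 2 R τ) Filter.atTop (nhds 0)) ∧ ∀ [𝒟.metric.HasLeviCivita], let outer : Set 𝒟.carrier := 𝒟.metric.causalFuture 𝒟.timeOrientation (Set.range 𝒟.embed) ∩ {q | ∃ (p : X) (γ : ℝ → 𝒟.carrier) (dom : Set ℝ), 𝒟.metric.IsNormalisedNullRayFrom 𝒟.timeOrientation 𝒟.embed 𝒟.normal p γ dom ∧ ¬ BddAbove dom ∧ q ∈ 𝒟.metric.chronologicalPast 𝒟.timeOrientation (γ '' (dom ∩ Set.Ici 0))}; ∃ r₀ : ℝ, 0 < r₀ ∧ ∃ Λ : NNReal, ∀ q ∈ outer, let U : TopologicalSpace.Opens E4 := ⟨Metric.ball (0 : E4) r₀, Metric.isOpen_ball⟩;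 ∃ Ψ : U → 𝒟.carrier, 𝒟.toSpacetime.IsLateChart (Minkowski.backgroundOn U) Set.univ (-r₀) Ψ ∧ (∃ x : U, (x : E4) = 0 ∧ Ψ x = q) ∧ supCkENorm (U : Set E4) 3 (𝒟.toSpacetime.deviationExtend (Minkowski.backgroundOn U) Ψ) ≤ (Λ : ENNReal) ∧ supCkENorm (U : Set E4) 0 (𝒟.toSpacetime.deviationExtend (Minkowski.backgroundOn U) Ψ) ≤ 1 / 2) →
    (∃ t : 𝒟.carrier → ℝ, ContMDiff (𝓡 4) 𝓘(ℝ, ℝ) (⊤ : ℕ∞) t ∧ ∀ [𝒟.metric.HasLeviCivita], let outer : Set 𝒟.carrier := 𝒟.metric.causalFuture 𝒟.timeOrientation (Set.range 𝒟.embed) ∩ {q | ∃ (p : X) (γ : ℝ → 𝒟.carrier) (dom : Set ℝ), 𝒟.metric.IsNormalisedNullRayFrom 𝒟.timeOrientation 𝒟.embed 𝒟.normal p γ dom ∧ ¬ BddAbove dom ∧ q ∈ 𝒟.metric.chronologicalPast 𝒟.timeOrientation (γ '' (dom ∩ Set.Ici 0))}; (∃ r₀ : ℝ, 0 < r₀ ∧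 ∃ Λ : NNReal, ∃ c : ℝ, 1 ≤ c ∧ ∀ q ∈ outer, let U : TopologicalSpace.Opens E4 := ⟨Metric.ball (0 : E4) r₀, Metric.isOpen_ball⟩; ∃ Ψ : U → 𝒟.carrier, 𝒟.toSpacetime.IsLateChart (Minkowski.backgroundOn U) Set.univ (-r₀) Ψ ∧ (∃ x : U, (x : E4) = 0 ∧ Ψ x = q) ∧ supCkENorm (U : Set E4) 3 (𝒟.toSpacetime.deviationExtend (Minkowski.backgroundOn U) Ψ) ≤ (Λ : ENNReal) ∧ supCkENorm (U : Set E4) 0 (𝒟.toSpacetime.deviationExtend (Minkowski.backgroundOn U) Ψ) ≤ 1 / 10 ∧ let f : E4 → ℝ := Function.extend Subtype.val (t ∘ Ψ) 0; ∃ lam : ℝ, c⁻¹ ≤ lam ∧ lam ≤ c ∧ ∀ x : U, ∀ v : E4, |fderiv ℝ f x.1 v - lam * v 0| ≤ (lam / 10) * ‖v‖) ∧ 𝒟.toCauchyDevelopment.HasEventuallyRedShiftedHorizon outer t) →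
    (∀ (K₀ K : Set E3) (M R Λ κ₀ : ℝ) (G : E4 → E4 →L[ℝ] E4 →L[ℝ] ℝ) (N L : E4 → E4) (ρ κ : E4 → ℝ),
      0 ≤ M →
      0 ≤ R →
      0 < Λ →
      0 < κ₀ →
      (IsCompact K₀ ∧ IsConnected K₀ᶜ) →
      IsCompact K →
      K₀ ⊆ interior K →
      K ⊆ Metric.closedBall (0 : E3) R →
      ContDiffOn ℝ 2 G {y : E4 | E4.spatial y ∉ K₀} →
      (∀ y : E4, E4.spatial y ∉ K₀ → ∀ m ≤ 2, ‖iteratedFDeriv ℝ m G y‖ ≤ Λ) →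
      (∀ y : E4, E4.spatial y ∉ K₀ → ∀ v w : E4, G y v w = G y w v) →
      (∀ y : E4, E4.spatial y ∉ K₀ → ∀ v : E4, v 0 = 0 → Λ⁻¹ * ‖v‖ ^ 2 ≤ G y v v) →
      (∀ y : E4, E4.spatial y ∉ K₀ → (∀ v : E4, v 0 = 0 → G y (N y) v = 0) ∧ G y (N y) (N y) = -1 ∧ ‖N y‖ ≤ Λ ∧ 0 < N y 0) →
      (∀ y : E4, E4.spatial y ∉ K₀ → MetricCoord.ricAt G y = 0) →
      (∀ y : E4, E4.spatial y ∉ K₀ → R < E4.spatialNorm y → ∀ m ≤ 2, ‖iteratedFDeriv ℝ m (fun z => G z - Kerr.bilin M 0 z) y‖ * E4.spatialNorm y ≤ Λ) →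
      (∀ δ : ℝ, 0 < δ → ∃ R' : ℝ, ∀ y : E4, E4.spatial y ∉ K₀ → R' < E4.spatialNorm y → ∀ m ≤ 1, ‖iteratedFDeriv ℝ m (fun z => fderiv ℝ G z (E4.basisVector 0)) y‖ * E4.spatialNorm y ≤ δ) →
      (∀ y : E4, E4.spatial y ∉ K₀ → R < E4.spatialNorm y → 0 < ρ y) →
      (∀ y : E4, E4.spatial y ∉ K₀ → E4.spatial y ∈ K → ρ y < 0) →
      ContDiffOn ℝ 2 ρ {y : E4 | E4.spatial y ∉ K₀} →
      (∀ y : E4, E4.spatial y ∉ K₀ → ‖fderiv ℝ ρ y‖ ≤ Λ ∧ (ρ y = 0 → Λ⁻¹ ≤ ‖fderiv ℝ ρ y‖)) →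
      ContDiffOn ℝ 1 L {y : E4 | E4.spatial y ∉ K₀} →
      (∀ y : E4, E4.spatial y ∉ K₀ → ρ y = 0 → ‖L y‖ ≤ Λ ∧ ‖fderiv ℝ L y‖ ≤ Λ ∧ L y 0 = 1 ∧ G y (L y) (L y) = 0 ∧ fderiv ℝ ρ y (L y) = 0 ∧ ∀ X : E4, fderiv ℝ ρ y X = 0 → G y (L y) X = 0) →
      (∀ y : E4, E4.spatial y ∉ K₀ → ρ y = 0 → fderiv ℝ L y (L y) + MetricCoord.chrAt G y (L y) (L y) = κ y • L y ∧ κ₀ ≤ κ y) →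
      (∀ y : E4, E4.spatial y ∉ K₀ → ρ y = 0 → ∀ X Y : E4, fderiv ℝ ρ y X = 0 → fderiv ℝ ρ y Y = 0 → G y (fderiv ℝ L y X + MetricCoord.chrAt G y X (L y)) Y + G y X (fderiv ℝ L y Y + MetricCoord.chrAt G y Y (L y)) = 0) →
      (∀ c : ℝ, IsCompact {y : E4 | E4.spatial y ∉ K₀ ∧ ρ y = 0 ∧ y 0 = c}) →
      (∀ y : E4, E4.spatial y ∉ K₀ → ρ y = 0 → ∃ γ : ℝ → E4, γ 0 = y ∧ ∀ s : ℝ, HasDerivAt γ (L (γ s)) s ∧ E4.spatial (γ s) ∉ K₀ ∧ ρ (γ s) = 0) →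
      (∃ (M' a : ℝ) (χ : E4 → E4), 0 < M' ∧ |a| < M' ∧ ContDiffOn ℝ 2 χ {y : E4 | E4.spatial y ∉ K₀ ∧ 0 < ρ y} ∧ Set.InjOn χ {y : E4 | E4.spatial y ∉ K₀ ∧ 0 < ρ y} ∧ χ '' {y : E4 | E4.spatial y ∉ K₀ ∧ 0 < ρ y} = (Kerr.exterior M' a : Set E4) ∧ ∀ y : E4, E4.spatial y ∉ K₀ → 0 < ρ y → (fderiv ℝ χ y).IsInvertible ∧ ∀ v w : E4, G y v w = Kerr.bilin M' a (χ y) (fderiv ℝ χ y v) (fderiv ℝ χ y w)) ∨ ((∀ y : E4, E4.spatial y ∉ K₀ → 0 < ρ y) ∧ ∃ χ : E4 → E4, ContDiffOn ℝ 2 χ {y : E4 | E4.spatial y ∉ K₀} ∧ Set.InjOn χ {y : E4 | E4.spatial y ∉ K₀} ∧ χ '' {y : E4 | E4.spatial y ∉ K₀} = Set.univ ∧ ∀ y : E4, E4.spatial y ∉ K₀ → (fderiv ℝ χ y).IsInvertible ∧ ∀ v w : E4, G y v w = Minkowski.bilin (fderiv ℝ χ y v) (fderiv ℝ χ y w)))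 →
    ∃ (O : Set 𝒟.carrier) (d : FinalStateDecomposition 𝒟.toSpacetime O 2), O = Summit.FinalStateConjecture.exteriorOf 𝒟.toCauchyDevelopment d.charted ∧ Summit.FinalStateConjecture.HasExhaustiveCharts d := by
  sorry

/-! ## The composition: the five stubs give the crux BY NAME -/

/-- **`ChannelsResolveTameDevelopments` from the line `secular-modes-die-at-silent-ends`.** Real proof (logic only):
the antecedent `K1 = UniformPhotonSphereChannels` is introduced and discarded (the Disproof's `of_tameResolution`
shape — the line proves the consequent `Φ` outright); for `X, D, 𝒟` with complete `𝓘⁺` and hypotheses (i)–(ii),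
`stub_tameRedShiftClock` supplies the red-shifted tame clock, the three limit-level stubs compose to the universal rigidity
"c1–c26 ⇒ KerrChart" (stub 4 fed with stub 2 on the far clauses and stub 3 on the horizon clauses), and
`stub_tameLaSalleTransfer` turns clock + rigidity into the honest exhaustive decomposition. -/
theorem ChannelsResolveTameDevelopments_of :
    Summit.FinalStateConjecture.FinalStateConjecture.Theses.PhotonSphereChannels.ChannelsResolveTameDevelopments := by
  intro _hK1 X _ _ _ _ _ _ D hD 𝒟 hmax hscri hΦ
  exact stub_tameLaSalleTransfer X D hD 𝒟 hmax hscri hΦ (stub_tameRedShiftClock X D hD 𝒟 hmax hscri hΦ)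
    (fun K₀ K M R Λ κ₀ G N L ρ κ c1 c2 c3 c4 c5 c6 c7 c8 c9 c10 c11 c12 c13 c14 c15 c16 c17 c18 c19 c20 c21 c22
        c23 c24 c25 c26 =>
      stub_killingEndsRigidity K₀ K M R Λ κ₀ G N L ρ κ c1 c2 c3 c4 c5 c6 c7 c8 c9 c10 c11 c12 c13 c14 c15 c16 c17 c18 c19
        c20 c21 c22 c23 c24 c25 c26
        (stub_farSecularFreezing K₀ K M R Λ G N c1 c2 c3 c5 c6 c7 c8 c9 c10 c11 c12 c13 c14 c15 c16)
        (stub_horizonTransientFreezing K₀ K Λ κ₀ G N L ρ κ c3 c4 c5 c6 c7 c9 c10 c11 c12 c13 c14 c18 c19 c20 c21 c22 c23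
          c24 c25 c26))

/-! ## Sanity (not stubs): the crux and its antecedent are in scope by name; nothing here restates them -/

example : Prop := Summit.FinalStateConjecture.FinalStateConjecture.Theses.PhotonSphereChannels.UniformPhotonSphereChannels

end Summit.FinalStateConjecture.FinalStateConjecture.Cruxes.ChannelsResolveTameDevelopments.SecularModesDieAtSilentEnds

end
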